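import Summits.QuantumFields.YangMills.Theorems.FluctuationComparisonRegPrIntLOrganTangentFibredChartData
import Summits.QuantumFields.YangMills.Theorems.FluctuationComparisonRegPrIntLOrganTangentWindowAbsContFromHeight
import HarnessLib

/-!
# `FluctuationComparisonRegPrIntLOrganTangentFibredChartFromHeight` — (L12b) «THE CHART FROM A HEIGHT, AS DATA»: the explicit spliced triangular chart of
# `descend F ℰp j` (✓`…OrganTangentFibredChartData`, file 1∕2) INSTANTIATED FROM A HEIGHT at the v2.6 top `24∕25`, for every family, with every letter displayed as a conclusion

Cell `ym3-torus` (rung R3 = continuum `SU(2)` Yang–Mills on T³ — NOT d = 4, NOT infinite volume, NOT a mass gap, NOT Clay), width seat `ym-ust-20520-w5` (gen 22),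
pen (L12) (LEAD-20520 w3 g23 WORD №16 (L12) ∕ №17 (iii); ★★OWNER g40 №215), file 2∕2.  `--kind proof --supports stmt-QuantumFields-20520 --as helper`, count-neutral,
definition-free, default heartbeats; THEOREMS ONLY; nothing printed is asserted.

§2 ★★★ `exists_height_fibredChart` — for EVERY `F : T3Family`, `0 < γ ≤ 1`, `0 < b₀`, `0 < p₀`: `∃ jA, ∀ j ≥ jA, ∃ Ω T T′ θ jac M s Φ J,` ⟨the eighteen one-bond letters
of ✓(L11) `exists_height_oneBondLaw` VERBATIM⟩ ∧ ⟨LIFT at `24∕25` (✓(β′) `spreadLift_height_all` + ✓`liftFloor_lt_twentyFour_div_twentyFive`)⟩ ∧ ⟨section: continuous,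
measurable, `descend ∘ s = id`, gain 1 (✓`exists_continuous_section_descend`)⟩ ∧ ⟨the fourteen chart letters of ✓`fibredChart_of_oneBondLaws_of_lift` at `cW := 24∕25`⟩
— the chart from a height AS DATA (the one-step brick of the m-step CHART-LEVEL composition; LEAD erratum 20:46Z: packages do not compose, charts do).
§3 ★ `exists_height_regularPackage_forall_disintegration` — docking corollary (no restatement of ✓(L8), which is the `∃ σ₀` edition with the disintegration constructed):
from a height, the (A)-package at `24∕25` for EVERY disintegration `σ₀` of `dU_{j+1}` along `descend` (Markov ∕ bind ∕ fibre) = §2 ∘ ✓BRIDGE′c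
`regularPackage_of_fibredChart_of_integrand`.
NOT HERE: the m-step composition itself; (u)∕(s)∕COAREA∘ (✓`…CoareaClosed`); anything of Bałaban's estimates.  No `def`, `instance`, `sorry`.
[cite: Balaban1987RG1, (0.4) p.253, (0.13) p.254, (0.18) p.255, (2.4) p.266 and (2.10) p.267; Balaban1985Averaging, (10)-(13) p.19]

HONEST: compositions of landed kernel facts (✓(L7)(L8)(L11), ✓(β′), ✓DescendSection, ✓MASSc, ✓TRIc's re-cut, ✓BRIDGE′c) on the (0.4) block average; nothing of
Bałaban's RG estimates is asserted or proved; O1 ∕ LIN∘ ∕ JVAR∘ ∕ UNIQ-MAX∘ ∕ crux 20520 `FluctuationComparisonRegPrIntL` ∕ `YM3TorusSU2` NOT proved; the registry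
`Lines/semiclassical_s2beta.lean` v11.4 (★★OWNER RULING №36) untouched; rung R3 = SU(2) YM₃ on T³ — NOT d = 4, NOT infinite volume, NOT a mass gap, NOT Clay; the Yang–Mills
mass gap is NOT proved by any of this.
-/

set_option autoImplicit false

noncomputable section

namespace Summit.QuantumFields.YangMills.Theorems.FluctuationComparisonRegPrIntLOrganTangentFibredChartFromHeight

open MeasureTheory ProbabilityTheory Filter Topology Set Function
open scoped ENNReal NNReal
open Literature.MathematicalPhysics.QuantumFieldTheory.Balaban1983to89
open T3ContinuumYM3Torus T3NestedUnitLaws T3UnitLawDensityEML T3UnitScaleTilt T3LevelShift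
open Literature.MathematicalPhysics.QuantumFieldTheory.Balaban1983to89.T3OrbitAverage
open Literature.MathematicalPhysics.QuantumFieldTheory.Balaban1983to89.BlockAveragingHaarAC (centralBond)
open Summit.QuantumFields.YangMills.Theorems.OrganTangentFibreMeanTools
open Summit.QuantumFields.YangMills.Theorems.FluctuationComparisonRegPrIntLOrganTangentFibredChartData (fibredChart_of_oneBondLaws_of_lift)
open Summit.QuantumFields.YangMills.Theorems.FluctuationComparisonRegPrIntLOrganTangentWindowAbsContFromHeight (exists_height_oneBondLaw)
open Summit.QuantumFields.YangMills.Theorems.OrganTangentDescendSection (exists_continuous_section_descend)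
open Summit.QuantumFields.YangMills.Theorems.SpreadLiftAllL (spreadLift_height_all)
open Summit.QuantumFields.YangMills.Theorems.OrganTangentAPackageAtDescend (liftFloor_lt_twentyFour_div_twentyFive)

/-! ## §2 The chart from a height, AS DATA (`cW := 24∕25`) -/

/-- ★★★ **THE FIBRED CHART OF `descend` FROM A HEIGHT, AS DATA.**  For every family `F`, every `0 < γ ≤ 1`, `0 < b₀`, `0 < p₀` there is a height `jA` such that at
every `j ≥ jA` there are per-bond one-variable inverse-law data `Ω T T′ θ jac M` with the one-bond letters of ✓`exists_height_oneBondLaw` VERBATIM (its 18 conjuncts), the LIFT letter at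
`24∕25` (✓`SpreadLiftAllL.spreadLift_height_all`), a continuous measurable global section `s` of `descend F ℰp j` with gain `1` (✓`exists_continuous_section_descend`),
and the explicit spliced chart `(Φ, J)` of §1 at `cW := 24∕25` with all its letters.
[cite: Balaban1987RG1, (0.4) p.253, (0.18) p.255, (2.4) p.266 and (2.10) p.267; Balaban1985Averaging, (10)-(13) p.19] -/
theorem exists_height_fibredChart
    (F : T3Family) (γ b₀ p₀ : ℝ) (hγ : 0 < γ) (hγ1 : γ ≤ 1) (hb₀ : 0 < b₀) (hp₀ : 0 < p₀) :
    ∃ jA : ℕ, ∀ (j : ℕ), jA ≤ j →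
      ∃ (Ω T T' : PBond (F.P j) 0 → GaugeField (F.P (j + 1)) 0 ↥(Matrix.specialUnitaryGroup (Fin 2) ℂ) → Set ↥(Matrix.specialUnitaryGroup (Fin 2) ℂ))
        (θ : PBond (F.P j) 0 → GaugeField (F.P (j + 1)) 0 ↥(Matrix.specialUnitaryGroup (Fin 2) ℂ) →
          ↥(Matrix.specialUnitaryGroup (Fin 2) ℂ) → ↥(Matrix.specialUnitaryGroup (Fin 2) ℂ))
        (jac : PBond (F.P j) 0 → GaugeField (F.P (j + 1)) 0 ↥(Matrix.specialUnitaryGroup (Fin 2) ℂ) → ↥(Matrix.specialUnitaryGroup (Fin 2) ℂ) → ℝ≥0) (M : ℝ≥0)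
        (s : GaugeField (F.P j) 0 ↥(Matrix.specialUnitaryGroup (Fin 2) ℂ) → GaugeField (F.P (j + 1)) 0 ↥(Matrix.specialUnitaryGroup (Fin 2) ℂ))
        (Φ : GaugeField (F.P j) 0 ↥(Matrix.specialUnitaryGroup (Fin 2) ℂ) × GaugeField (F.P (j + 1)) 0 ↥(Matrix.specialUnitaryGroup (Fin 2) ℂ) →
          GaugeField (F.P (j + 1)) 0 ↥(Matrix.specialUnitaryGroup (Fin 2) ℂ))
        (J : GaugeField (F.P j) 0 ↥(Matrix.specialUnitaryGroup (Fin 2) ℂ) × GaugeField (F.P (j + 1)) 0 ↥(Matrix.specialUnitaryGroup (Fin 2) ℂ) → ℝ≥0),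
        -- ===== the one-bond letters of ✓`exists_height_oneBondLaw` (18 conjuncts, VERBATIM) =====
        -- measurability (hΩm hTm hθm hjm)
        ((∀ c, MeasurableSet {p : GaugeField (F.P (j + 1)) 0 ↥(Matrix.specialUnitaryGroup (Fin 2) ℂ) × ↥(Matrix.specialUnitaryGroup (Fin 2) ℂ) | p.2 ∈ Ω c p.1}) ∧
        (∀ c, MeasurableSet {p : GaugeField (F.P (j + 1)) 0 ↥(Matrix.specialUnitaryGroup (Fin 2) ℂ) × ↥(Matrix.specialUnitaryGroup (Fin 2) ℂ) | p.2 ∈ T c p.1}) ∧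
        (∀ c, Measurable fun p : GaugeField (F.P (j + 1)) 0 ↥(Matrix.specialUnitaryGroup (Fin 2) ℂ) × ↥(Matrix.specialUnitaryGroup (Fin 2) ℂ) => θ c p.1 p.2) ∧
        (∀ c, Measurable fun p : GaugeField (F.P (j + 1)) 0 ↥(Matrix.specialUnitaryGroup (Fin 2) ℂ) × ↥(Matrix.specialUnitaryGroup (Fin 2) ℂ) => jac c p.1 p.2) ∧
        -- blindness of the fine domain (hΩbl)
        (∀ c (U : GaugeField (F.P (j + 1)) 0 ↥(Matrix.specialUnitaryGroup (Fin 2) ℂ)) (g : PBond (F.P j) 0 → ↥(Matrix.specialUnitaryGroup (Fin 2) ℂ)),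
          Ω c (extend (fun c : PBond (F.P j) 0 => centralBond (bondShift (sitesPerDir_descend F j 0) c)) g U) = Ω c U) ∧
        -- right inverse (hright) and THE LAW (hlaw)
        (∀ c U, ∀ v ∈ T c U, descend F ℰp j (update U (centralBond (bondShift (sitesPerDir_descend F j 0) c)) (θ c U v)) c = v) ∧
        (∀ c U, (HaarData.haar : Measure ↥(Matrix.specialUnitaryGroup (Fin 2) ℂ)).restrict (Ω c U) =
          (((HaarData.haar : Measure ↥(Matrix.specialUnitaryGroup (Fin 2) ℂ)).restrict (T c U)).withDensity fun v => (jac c U v : ℝ≥0∞)).map (θ c U)) ∧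
        -- topology (hTo hT′T) and the margin
        (∀ c U, IsOpen (T c U)) ∧ (∀ c U, closure (T' c U) ⊆ T c U) ∧
        (∀ (U : GaugeField (F.P (j + 1)) 0 ↥(Matrix.specialUnitaryGroup (Fin 2) ℂ)) (V : GaugeField (F.P j) 0 ↥(Matrix.specialUnitaryGroup (Fin 2) ℂ)),
          (∀ c, V c ∈ T c U) → PlaqSmall (24 / 25 * θBal F.L γ b₀ p₀ (j + 1)) (extend (fun c : PBond (F.P j) 0 => centralBond (bondShift (sitesPerDir_descend F j 0) c)) (fun c => θ c U (V c)) U) → ∀ c, V c ∈ T' c U) ∧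
        -- small fields (hΩS), continuity (hθc hjc), the uniform bound (hjM)
        (∀ U : GaugeField (F.P (j + 1)) 0 ↥(Matrix.specialUnitaryGroup (Fin 2) ℂ), PlaqSmall (24 / 25 * θBal F.L γ b₀ p₀ (j + 1)) U → ∀ c, U (centralBond (bondShift (sitesPerDir_descend F j 0) c)) ∈ Ω c U) ∧
        (∀ c U, ContinuousOn (θ c U) (T c U)) ∧
        (∀ c U, ContinuousOn (fun v => (jac c U v : ℝ)) (T c U)) ∧
        (∀ c U v, jac c U v ≤ M) ∧
        -- the `mass_of_smallLift` letters (hTo, hθc joint; hsol) and positivity of the Jacobian on `T`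
        (∀ c, IsOpen {p : GaugeField (F.P (j + 1)) 0 ↥(Matrix.specialUnitaryGroup (Fin 2) ℂ) × ↥(Matrix.specialUnitaryGroup (Fin 2) ℂ) | p.2 ∈ T c p.1}) ∧
        (∀ c, ContinuousOn (fun p : GaugeField (F.P (j + 1)) 0 ↥(Matrix.specialUnitaryGroup (Fin 2) ℂ) × ↥(Matrix.specialUnitaryGroup (Fin 2) ℂ) =>
          θ c p.1 p.2) {p | p.2 ∈ T c p.1}) ∧
        (∀ U : GaugeField (F.P (j + 1)) 0 ↥(Matrix.specialUnitaryGroup (Fin 2) ℂ), PlaqSmall (24 / 25 * θBal F.L γ b₀ p₀ (j + 1)) U →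
          ∀ c, descend F ℰp j U c ∈ T' c U ∧ θ c U (descend F ℰp j U c) = U (centralBond (bondShift (sitesPerDir_descend F j 0) c))) ∧
        (∀ c U, ∀ v ∈ T c U, jac c U v ≠ 0)) ∧
        -- ===== the LIFT letter at `24∕25` (✓(β′)) =====
        (∀ V : GaugeField (F.P j) 0 ↥(Matrix.specialUnitaryGroup (Fin 2) ℂ), PlaqSmall (θBal F.L γ b₀ p₀ j) V →
          ∃ U₀ : GaugeField (F.P (j + 1)) 0 ↥(Matrix.specialUnitaryGroup (Fin 2) ℂ),
            descend F ℰp j U₀ = V ∧ PlaqSmall (24 / 25 * θBal F.L γ b₀ p₀ (j + 1)) U₀) ∧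
        -- ===== the section letters (✓`exists_continuous_section_descend`) =====
        (Continuous s ∧ Measurable s ∧ (∀ V, descend F ℰp j (s V) = V) ∧ (∀ (δ : ℝ), 0 < δ → ∀ V, PlaqSmall δ V → PlaqSmall δ (s V))) ∧
        -- ===== the chart letters of §1 at `cW := 24∕25` =====
        (Measurable Φ ∧ Measurable J ∧
        (∀ V U, (∀ c, V c ∈ T c U) →
          Φ (V, U) = extend (fun c : PBond (F.P j) 0 => centralBond (bondShift (sitesPerDir_descend F j 0) c)) (fun c => θ c U (V c)) U) ∧
        (∀ V U, ¬ (∀ c, V c ∈ T c U) → Φ (V, U) = s V) ∧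
        (∀ V U, (∀ c, V c ∈ T c U) → J (V, U) = ∏ c, jac c U (V c)) ∧
        (∀ V U, ¬ (∀ c, V c ∈ T c U) → J (V, U) = 0) ∧
        IsOpen {p : GaugeField (F.P j) 0 ↥(Matrix.specialUnitaryGroup (Fin 2) ℂ) × GaugeField (F.P (j + 1)) 0 ↥(Matrix.specialUnitaryGroup (Fin 2) ℂ) |
          ∀ c, p.1 c ∈ T c p.2} ∧
        ContinuousOn Φ {p | ∀ c, p.1 c ∈ T c p.2} ∧
        (∀ U, ContinuousOn (fun V => (J (V, U) : ℝ)) {V | ∀ c, V c ∈ T c U}) ∧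
        (∀ V U, descend F ℰp j (Φ (V, U)) = V) ∧
        (∀ A : Set (GaugeField (F.P j) 0 ↥(Matrix.specialUnitaryGroup (Fin 2) ℂ)), MeasurableSet A →
          (fieldMeasure (F.P (j + 1)) 0 ↥(Matrix.specialUnitaryGroup (Fin 2) ℂ)).restrict
              (descend F ℰp j ⁻¹' A ∩ {U | ∀ c, U (centralBond (bondShift (sitesPerDir_descend F j 0) c)) ∈ Ω c U}) =
            ((((fieldMeasure (F.P j) 0 ↥(Matrix.specialUnitaryGroup (Fin 2) ℂ)).restrict A).prod
                (fieldMeasure (F.P (j + 1)) 0 ↥(Matrix.specialUnitaryGroup (Fin 2) ℂ))).withDensity (fun p => (J p : ℝ≥0∞))).map Φ) ∧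
        (∀ f : GaugeField (F.P (j + 1)) 0 ↥(Matrix.specialUnitaryGroup (Fin 2) ℂ) → ℝ, Continuous f →
          (∀ U, f U ≠ 0 → PlaqSmall (24 / 25 * θBal F.L γ b₀ p₀ (j + 1)) U) →
          ∀ U : GaugeField (F.P (j + 1)) 0 ↥(Matrix.specialUnitaryGroup (Fin 2) ℂ),
            ContinuousOn (fun V => (J (V, U) : ℝ) * f (Φ (V, U))) {V | PlaqSmall (θBal F.L γ b₀ p₀ j) V}) ∧
        (∀ V U, (J (V, U) : ℝ) ≤ (M : ℝ) ^ Fintype.card (PBond (F.P j) 0)) ∧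
        (∀ V, PlaqSmall (θBal F.L γ b₀ p₀ j) V →
          0 < ∫⁻ U in {U | PlaqSmall (24 / 25 * θBal F.L γ b₀ p₀ (j + 1)) (Φ (V, U))}, (J (V, U) : ℝ≥0∞)
            ∂(fieldMeasure (F.P (j + 1)) 0 ↥(Matrix.specialUnitaryGroup (Fin 2) ℂ)))) := by
  obtain ⟨j₁, h₁⟩ := exists_height_oneBondLaw F γ b₀ p₀ hγ hγ1 hb₀
  obtain ⟨j₂, h₂⟩ := spreadLift_height_all liftFloor_lt_twentyFour_div_twentyFive F hγ hγ1 hb₀ hp₀.le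
  refine ⟨max j₁ j₂, fun j hj => ?_⟩
  obtain ⟨Ω, T, T', θ, jac, M, hΩm, hTm, hθm, hjm, hΩbl, hright, hlaw, hTo, hT'T, hmargin, hΩS, hθc, hjc, hjM, hToj, hθcj, hsol, hjne⟩ :=
    h₁ j (le_of_max_le_left hj)
  have hlift := h₂ j (le_of_max_le_right hj)
  obtain ⟨s, hsc, hsm, hs, hgain⟩ := exists_continuous_section_descend F j
  have hjpos : ∀ c U v, v ∈ T c U → 0 < jac c U v := fun c U v hv => pos_iff_ne_zero.2 (hjne c U v hv)
  have hsol' : ∀ U : GaugeField (F.P (j + 1)) 0 ↥(Matrix.specialUnitaryGroup (Fin 2) ℂ), PlaqSmall (24 / 25 * θBal F.L γ b₀ p₀ (j + 1)) U →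
      ∀ c, descend F ℰp j U c ∈ T c U ∧ θ c U (descend F ℰp j U c) = U (centralBond (bondShift (sitesPerDir_descend F j 0) c)) :=
    fun U hU c => ⟨subset_closure.trans (hT'T c U) (hsol U hU c).1, (hsol U hU c).2⟩
  obtain ⟨Φ, J, hchart⟩ := fibredChart_of_oneBondLaws_of_lift F γ b₀ p₀ j (24 / 25) Ω T θ jac hΩm hTm hθm hjm hΩbl hright hlaw T' hT'T
    (fun U V _ hVG hsmall => hmargin U V hVG hsmall) hjc M hjM hToj hθcj hjpos hsol' hlift s hsm hs
  exact ⟨Ω, T, T', θ, jac, M, s, Φ, J,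
    ⟨hΩm, hTm, hθm, hjm, hΩbl, hright, hlaw, hTo, hT'T, hmargin, hΩS, hθc, hjc, hjM, hToj, hθcj, hsol, hjne⟩,
    hlift, ⟨hsc, hsm, hs, hgain⟩, hchart⟩

/-! ## §3 Docking corollary: the (A)-package from a height for EVERY disintegration -/

/-- ★ **THE (A)-PACKAGE AT `24∕25` FROM A HEIGHT, FOR EVERY DISINTEGRATION `σ₀` OF `dU_{j+1}` ALONG `descend F ℰp j`** (Markov; `bind`; fibre): §2's chart fed to
✓`OrganTangentFibredChartBridgeIntegrandAnyCut.regularPackage_of_fibredChart_of_integrand` at `τ := dU_{j+1}`, base set the coarse window.  (✓(L8)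
`exists_height_regularSmallFieldDisintegration` is the `∃ σ₀` edition with the disintegration constructed; this is the `∀ σ₀` edition.)
[cite: Balaban1987RG1, (2.10) p.267 and (0.13) p.254; Balaban1985Averaging, (10)-(13) p.19] -/
theorem exists_height_regularPackage_forall_disintegration
    (F : T3Family) (γ b₀ p₀ : ℝ) (hγ : 0 < γ) (hγ1 : γ ≤ 1) (hb₀ : 0 < b₀) (hp₀ : 0 < p₀) :
    ∃ jA : ℕ, ∀ (j : ℕ), jA ≤ j →
      ∀ (σ₀ : Kernel (GaugeField (F.P j) 0 ↥(Matrix.specialUnitaryGroup (Fin 2) ℂ))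
          (GaugeField (F.P (j + 1)) 0 ↥(Matrix.specialUnitaryGroup (Fin 2) ℂ))),
        IsMarkovKernel σ₀ →
        (Measure.map (descend F ℰp j) (fieldMeasure (F.P (j + 1)) 0 ↥(Matrix.specialUnitaryGroup (Fin 2) ℂ))).bind ⇑σ₀ =
          fieldMeasure (F.P (j + 1)) 0 ↥(Matrix.specialUnitaryGroup (Fin 2) ℂ) →
        (∀ᵐ V ∂(Measure.map (descend F ℰp j) (fieldMeasure (F.P (j + 1)) 0 ↥(Matrix.specialUnitaryGroup (Fin 2) ℂ))),
          ∀ᵐ U ∂(σ₀ V), descend F ℰp j U = V) →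
        ∃ lam : GaugeField (F.P j) 0 ↥(Matrix.specialUnitaryGroup (Fin 2) ℂ) →
            Measure (GaugeField (F.P (j + 1)) 0 ↥(Matrix.specialUnitaryGroup (Fin 2) ℂ)),
          (∀ V, IsFiniteMeasure (lam V)) ∧
          (∀ f : GaugeField (F.P (j + 1)) 0 ↥(Matrix.specialUnitaryGroup (Fin 2) ℂ) → ℝ, Continuous f →
            (∀ U, f U ≠ 0 → PlaqSmall (24 / 25 * θBal F.L γ b₀ p₀ (j + 1)) U) →
            ContinuousOn (fun V => ∫ U, f U ∂(lam V)) {V | PlaqSmall (θBal F.L γ b₀ p₀ j) V}) ∧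
          (∀ V, PlaqSmall (θBal F.L γ b₀ p₀ j) V → 0 < lam V {U | PlaqSmall (24 / 25 * θBal F.L γ b₀ p₀ (j + 1)) U}) ∧
          (∃ c : GaugeField (F.P j) 0 ↥(Matrix.specialUnitaryGroup (Fin 2) ℂ) → ℝ,
            ∀ f : GaugeField (F.P (j + 1)) 0 ↥(Matrix.specialUnitaryGroup (Fin 2) ℂ) → ℝ, Continuous f →
              (∀ U, ¬ PlaqSmall (24 / 25 * θBal F.L γ b₀ p₀ (j + 1)) U → f U = 0) →
              ∀ᵐ V ∂(Measure.map (descend F ℰp j) (fieldMeasure (F.P (j + 1)) 0 ↥(Matrix.specialUnitaryGroup (Fin 2) ℂ))),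
                PlaqSmall (θBal F.L γ b₀ p₀ j) V → 0 < c V ∧ ∫ U, f U ∂(σ₀ V) = c V * ∫ U, f U ∂(lam V)) := by
  classical
  obtain ⟨jA, hjA⟩ := exists_height_fibredChart F γ b₀ p₀ hγ hγ1 hb₀ hp₀
  refine ⟨jA, fun j hj σ₀ hσ₀M hbind₀ hfib₀ => ?_⟩
  obtain ⟨Ω, T, T', θ, jac, M, s, Φ, J, ⟨-, -, -, -, -, -, -, -, -, -, hΩS, -, -, -, -, -, -, -⟩, -, -,
    hΦm, hJm, -, -, -, -, -, -, -, havgΦ, hmap, hint, hJB, hmass⟩ := hjA j hj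
  haveI : BorelSpace (GaugeField (F.P j) 0 ↥(Matrix.specialUnitaryGroup (Fin 2) ℂ)) := T3OrbitAverage.instBorelSpaceGaugeField
  have hWm : MeasurableSet {V : GaugeField (F.P j) 0 ↥(Matrix.specialUnitaryGroup (Fin 2) ℂ) | PlaqSmall (θBal F.L γ b₀ p₀ j) V} := by
    have e : {V : GaugeField (F.P j) 0 ↥(Matrix.specialUnitaryGroup (Fin 2) ℂ) | PlaqSmall (θBal F.L γ b₀ p₀ j) V} =
        ⋂ p : Plaq (F.P j) 0, {U | dist1 (GaugeField.plaqHol U p) < θBal F.L γ b₀ p₀ j} := by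
      ext U; simp only [PlaqSmall, Set.mem_setOf_eq, Set.mem_iInter]
    rw [e]
    exact (isOpen_iInter_of_finite fun p => isOpen_lt (continuous_dist1_plaqHol p) continuous_const).measurableSet
  haveI : IsProbabilityMeasure (fieldMeasure (F.P (j + 1)) 0 ↥(Matrix.specialUnitaryGroup (Fin 2) ℂ)) :=
    Missing.isProbabilityMeasure_fieldMeasure _ _
  exact OrganTangentFibredChartBridgeIntegrandAnyCut.regularPackage_of_fibredChart_of_integrand
    F γ b₀ p₀ j (24 / 25) σ₀ hσ₀M hbind₀ hfib₀
    (fieldMeasure (F.P (j + 1)) 0 ↥(Matrix.specialUnitaryGroup (Fin 2) ℂ)) Φ hΦm J hJm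
    {U | ∀ c, U (centralBond (bondShift (sitesPerDir_descend F j 0) c)) ∈ Ω c U} (fun U hU c => hΩS U hU c)
    (fun V _ U => havgΦ V U) (hmap _ hWm)
    (fun f hf hsupp => Eventually.of_forall (hint f hf hsupp))
    (fun _ => (M : ℝ) ^ Fintype.card (PBond (F.P j) 0)) (integrable_const _)
    (fun V _ => Eventually.of_forall (fun U => hJB V U)) hmass

end Summit.QuantumFields.YangMills.Theorems.FluctuationComparisonRegPrIntLOrganTangentFibredChartFromHeight

end
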